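import Summits.FinalStateConjecture.FinalStateConjecture.Theorems.EIHFluxBalanceInertialRecessionClampField
import Summits.FinalStateConjecture.FinalStateConjecture.Theorems.EIHFluxBalanceInertialRecessionFibred
import Summits.FinalStateConjecture.FinalStateConjecture.Theorems.EIHFluxBalanceInertialRecessionStubRechart3OtherHoles

/-!
# Route EIHFluxBalance — `InertialRecession`, re-charting: the model-coordinate clamp

Helper file for the crux `stmt-FinalStateConjecture-10166`
(`Summit.FinalStateConjecture.FinalStateConjecture.Theses.EIHFluxBalance.InertialRecession`),
line `sublinear-is-free-clean-window-charges`, stub `stub_rechart` (the transfer P2), part G1.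

The clock chart `ψ` is injective with invertible differential only on LATE BOUNDED model regions;
to obtain a globally defined open embedding one pre-composes it with the **clamp**
`C(y) = (θ(y⁰), ρ(θ y⁰) G̃(ỹ/ρ(θ y⁰)))` (time clamp `θ` onto the late half-line, coordinate clamp
`G̃` of `…Clamp`/`…ClampField` at the slowly growing scale `ρ` of `…Profile`). This file: `C` is a
smooth open embedding of `E4` with injective differentials (`isOpenEmbedding_clampMap`,
`injective_fderiv_clampMap`), it is the identity near every late point of small offset
(`clampMap_eventuallyEq_id`), its spatial part is `< 2ρ` and `≤ ‖ỹ‖`, and the Kerr–Schild radius of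
`C y` is either that of `y` or at least `ρ/2 − |a|` (`radius_clampMap`). [folklore]
-/

noncomputable section

set_option linter.dupNamespace false

open Set Filter Function Metric Topology
open scoped ContDiff
open Literature.Geometry.Lorentzian

namespace Summit.FinalStateConjecture.FinalStateConjecture.Theorems.SublinearIsFree.Rechart

/-- **The clamp** `C(y) = (θ(y⁰), ρ(θ y⁰) G̃(ỹ/ρ(θ y⁰)))`. [folklore] -/
def clampMap (θ ρ Gt : ℝ → ℝ) (y : E4) : E4 :=
  E4.ofTimeSpace (θ (y 0))
    ((ρ (θ (y 0))) • (WithLp.toLp 2 fun k ↦ Gt ((ρ (θ (y 0)))⁻¹ * E4.spatial y k) : E3))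

section Clamp

variable (θ ρ Gt : ℝ → ℝ)

/-- The time of the clamped point. [folklore] -/
@[simp] theorem clampMap_apply_zero (y : E4) : clampMap θ ρ Gt y 0 = θ (y 0) := by
  rw [clampMap, E4.ofTimeSpace_apply_zero]

/-- The spatial part of the clamped point is the clamp field at scale `ρ ∘ θ`. [folklore] -/
theorem spatial_clampMap (y : E4) : E4.spatial (clampMap θ ρ Gt y) =
    ((ρ ∘ θ) (y 0)) • (WithLp.toLp 2 fun k ↦ Gt (((ρ ∘ θ) (y 0))⁻¹ * E4.spatial y k) : E3) := by
  rw [clampMap, E4.spatial_ofTimeSpace]; rfl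

/-- The clamp is the fibred clamp at scale `ρ ∘ θ` followed by the time reparametrisation `θ`.
[folklore] -/
theorem clampMap_eq_comp : clampMap θ ρ Gt =
    (fun z : E4 ↦ E4.ofTimeSpace (θ (z 0)) (E4.spatial z)) ∘
      fun y : E4 ↦ E4.ofTimeSpace (y 0)
        (((ρ ∘ θ) (y 0)) • (WithLp.toLp 2 fun k ↦ Gt (((ρ ∘ θ) (y 0))⁻¹ * E4.spatial y k) : E3)) := by
  funext y
  simp only [Function.comp_apply, E4.ofTimeSpace_apply_zero, E4.spatial_ofTimeSpace, clampMap]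

variable {θ ρ Gt} (hθ : ContDiff ℝ ∞ θ) (hθ' : ∀ w, 0 < deriv θ w) (hρ : ContDiff ℝ ∞ ρ)
  (hρ0 : ∀ t, 0 < ρ t) (hGt : ContDiff ℝ ∞ Gt) (hGm : StrictMono Gt) (hGd : ∀ u, 0 < deriv Gt u)

include hθ hρ hρ0 hGt in
/-- The fibre field of the clamp is jointly smooth. [folklore] -/
theorem contDiff_clampFibre : ContDiff ℝ ∞ fun p : ℝ × E3 ↦
    (((ρ ∘ θ) p.1) • (WithLp.toLp 2 fun k ↦ Gt (((ρ ∘ θ) p.1)⁻¹ * p.2 k) : E3)) :=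
  contDiff_clampField hGt (hρ.comp hθ) fun _ ↦ hρ0 _

include hθ hρ hρ0 hGt in
/-- The clamp is smooth. [folklore] -/
theorem contDiff_clampMap : ContDiff ℝ ∞ (clampMap θ ρ Gt) := by
  have h0 : ContDiff ℝ ∞ fun y : E4 ↦ y 0 := (EuclideanSpace.proj (0 : Fin 4) : E4 →L[ℝ] ℝ).contDiff
  have hfun : clampMap θ ρ Gt = fun y ↦ (θ (y 0)) • E4.basisVector 0 + E4.spaceEmbed
      ((((ρ ∘ θ) (y 0)) • (WithLp.toLp 2 fun k ↦ Gt (((ρ ∘ θ) (y 0))⁻¹ * E4.spatial y k) : E3))) := by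
    funext y; rw [clampMap, E4.ofTimeSpace_eq_smul_add']; rfl
  rw [hfun]
  exact ((hθ.comp h0).smul contDiff_const).add (E4.spaceEmbed.contDiff.comp
    ((contDiff_clampFibre hθ hρ hρ0 hGt).comp (h0.prodMk E4.spatial.contDiff)))

include hθ hθ' hρ hρ0 hGt hGm hGd in
/-- **The clamp is an open embedding of `E4`.** [folklore] -/
theorem isOpenEmbedding_clampMap : Topology.IsOpenEmbedding (clampMap θ ρ Gt) := by
  rw [clampMap_eq_comp]
  refine (isOpenEmbedding_timeReparam hθ hθ').comp ?_
  exact isOpenEmbedding_fibred' (contDiff_clampFibre hθ hρ hρ0 hGt)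
    (fun t ↦ injective_clampField hGm (fun _ ↦ hρ0 _) t)
    (fun t z ↦ injective_fderiv_clampField' hGt hGd (hρ.comp hθ) (fun _ ↦ hρ0 _) t z)

include hθ hθ' hρ hρ0 hGt hGd in
/-- **The differential of the clamp is injective everywhere.** [folklore] -/
theorem injective_fderiv_clampMap (y : E4) : Injective (fderiv ℝ (clampMap θ ρ Gt) y) := by
  set g : ℝ → E3 → E3 := fun t z ↦ (((ρ ∘ θ) t) • (WithLp.toLp 2 fun k ↦ Gt (((ρ ∘ θ) t)⁻¹ * z k) : E3))
    with hg
  have hGc : ContDiff ℝ ∞ fun p : ℝ × E3 ↦ g p.1 p.2 := contDiff_clampFibre hθ hρ hρ0 hGt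
  have hGd' : DifferentiableAt ℝ (fun p : ℝ × E3 ↦ g p.1 p.2) (y 0, E4.spatial y) :=
    (hGc.differentiable (by simp)).differentiableAt
  -- the derivative of the clamp
  have h0 : HasFDerivAt (fun y : E4 ↦ y 0) (EuclideanSpace.proj (0 : Fin 4) : E4 →L[ℝ] ℝ) y :=
    (EuclideanSpace.proj (0 : Fin 4) : E4 →L[ℝ] ℝ).hasFDerivAt
  have hθd : HasDerivAt θ (deriv θ (y 0)) (y 0) := ((hθ.differentiable (by simp)) _).hasDerivAt
  have h1 : HasFDerivAt (fun y : E4 ↦ θ (y 0))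
      (deriv θ (y 0) • (EuclideanSpace.proj (0 : Fin 4) : E4 →L[ℝ] ℝ)) y := hθd.comp_hasFDerivAt y h0
  have hp : HasFDerivAt (fun y : E4 ↦ (y 0, E4.spatial y))
      ((EuclideanSpace.proj (0 : Fin 4) : E4 →L[ℝ] ℝ).prod E4.spatial) y := h0.prodMk E4.spatial.hasFDerivAt
  have h2 := hGd'.hasFDerivAt.comp y hp
  have hfun : clampMap θ ρ Gt = fun y ↦ (θ (y 0)) • E4.basisVector 0 + E4.spaceEmbed (g (y 0) (E4.spatial y)) := by
    funext y; rw [clampMap, E4.ofTimeSpace_eq_smul_add']; rfl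
  have hC : HasFDerivAt (clampMap θ ρ Gt) ((deriv θ (y 0) • (EuclideanSpace.proj (0 : Fin 4) : E4 →L[ℝ] ℝ)).smulRight
      (E4.basisVector 0) + E4.spaceEmbed.comp ((fderiv ℝ (fun p : ℝ × E3 ↦ g p.1 p.2) (y 0, E4.spatial y)).comp
        ((EuclideanSpace.proj (0 : Fin 4) : E4 →L[ℝ] ℝ).prod E4.spatial))) y := by
    rw [hfun]
    exact (h1.smul_const _).add (E4.spaceEmbed.hasFDerivAt.comp y h2)
  rw [hC.fderiv]
  intro d d' hdd
  rw [← sub_eq_zero] at hdd ⊢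
  rw [← map_sub] at hdd
  set e := d - d' with he
  have hzero : (deriv θ (y 0) * e 0) • E4.basisVector 0 +
      E4.spaceEmbed (fderiv ℝ (fun p : ℝ × E3 ↦ g p.1 p.2) (y 0, E4.spatial y) (e 0, E4.spatial e)) = 0 := by
    have := hdd
    simp only [add_apply, ContinuousLinearMap.smulRight_apply, ContinuousLinearMap.coe_comp,
      Function.comp_apply, ContinuousLinearMap.prod_apply, FunLike.coe_smul, Pi.smul_apply,
      PiLp.proj_apply, smul_eq_mul] at this
    exact this
  obtain ⟨ht, hs⟩ := smul_basisVector_add_spaceEmbed_eq_zero hzero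
  have he0 : e 0 = 0 := by
    rcases mul_eq_zero.mp ht with h | h
    · exact absurd h (hθ' (y 0)).ne'
    · exact h
  rw [he0, ← fderiv_fibre_apply (g := g) hGd'] at hs
  have hes : E4.spatial e = 0 :=
    injective_fderiv_clampField' hGt hGd (hρ.comp hθ) (fun _ ↦ hρ0 _) (y 0) (E4.spatial y)
      (a₁ := E4.spatial e) (a₂ := 0) (by rw [map_zero]; exact hs)
  rw [eq_smul_basisVector_add_spaceEmbed e, he0, hes, zero_smul, map_zero, add_zero]

/-! ### The honest zone and the size of the clamped point -/

variable (hGid : ∀ u, |u| ≤ 1 / 2 → Gt u = u) (hGlt : ∀ u, |Gt u| < 1)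
  (hGgt : ∀ u, 1 / 2 < |u| → 1 / 2 < |Gt u|) (hGle : ∀ u, |Gt u| ≤ |u|)

include hρ0 hGid in
/-- On the honest zone the clamp is the identity: `θ(y⁰) = y⁰` and `‖ỹ‖ ≤ ρ(y⁰)/2` give `C y = y`.
[folklore] -/
theorem clampMap_eq_self {y : E4} (hθy : θ (y 0) = y 0) (hy : ‖E4.spatial y‖ ≤ ρ (y 0) / 2) :
    clampMap θ ρ Gt y = y := by
  rw [clampMap, hθy]
  have h := clampField_eq_self (Gt := Gt) (ρ := ρ) hGid hρ0 (y 0) hy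
  rw [h]
  exact E4.ofTimeSpace_time_spatial y

include hρ hρ0 hGid in
/-- **The clamp is the identity near every late point of small offset**: if `θ = id` on
`[T₁, ∞)`, `T₁ < y⁰` and `‖ỹ‖ < ρ(y⁰)/2`, then `C = id` near `y`. [folklore] -/
theorem clampMap_eventuallyEq_id {T₁ : ℝ} (hθid : ∀ s, T₁ ≤ s → θ s = s) {y : E4} (hy0 : T₁ < y 0)
    (hy : ‖E4.spatial y‖ < ρ (y 0) / 2) : clampMap θ ρ Gt =ᶠ[𝓝 y] id := by
  have h0 : Continuous fun z : E4 ↦ z 0 := (EuclideanSpace.proj (0 : Fin 4) : E4 →L[ℝ] ℝ).continuous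
  have hopen : IsOpen {z : E4 | T₁ < z 0 ∧ ‖E4.spatial z‖ < ρ (z 0) / 2} :=
    (isOpen_lt continuous_const h0).inter (isOpen_lt (continuous_norm.comp E4.spatial.continuous)
      ((hρ.continuous.comp h0).div_const _))
  filter_upwards [hopen.mem_nhds ⟨hy0, hy⟩] with z hz
  exact clampMap_eq_self hρ0 hGid (hθid _ hz.1.le) hz.2.le

include hρ0 hGlt in
/-- The clamped point has spatial part of norm `< 2 ρ(θ y⁰)`. [folklore] -/
theorem norm_spatial_clampMap_lt (y : E4) : ‖E4.spatial (clampMap θ ρ Gt y)‖ < 2 * ρ (θ (y 0)) := by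
  rw [spatial_clampMap]
  exact norm_clampField_lt (ρ := ρ ∘ θ) hGlt (fun _ ↦ hρ0 _) (y 0) (E4.spatial y)

include hρ0 hGle in
/-- The clamp does not increase the spatial offset. [folklore] -/
theorem norm_spatial_clampMap_le (y : E4) : ‖E4.spatial (clampMap θ ρ Gt y)‖ ≤ ‖E4.spatial y‖ := by
  rw [spatial_clampMap]
  exact norm_clampField_le (ρ := ρ ∘ θ) hGle (fun _ ↦ hρ0 _) (y 0) (E4.spatial y)

include hρ0 hGid hGgt in
/-- **The Kerr–Schild radius of the clamped point** is either that of `y` (honest zone) or at least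
`ρ(θ y⁰)/2 − |a|` (clamp zone). [folklore] -/
theorem radius_clampMap (a : ℝ) (y : E4) : Kerr.radius a (clampMap θ ρ Gt y) = Kerr.radius a y ∨
    ρ (θ (y 0)) / 2 - |a| ≤ Kerr.radius a (clampMap θ ρ Gt y) := by
  by_cases hy : ‖E4.spatial y‖ ≤ ρ (θ (y 0)) / 2
  · left
    refine Kerr.radius_eq_of_spatial_eq a ?_
    rw [spatial_clampMap]
    exact clampField_eq_self (Gt := Gt) (ρ := ρ ∘ θ) hGid (fun _ ↦ hρ0 _) (y 0) hy
  · right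
    push Not at hy
    have h1 := min_le_norm_clampField' (ρ := ρ ∘ θ) hGid hGgt (fun _ ↦ hρ0 _) (y 0) (E4.spatial y)
    rw [← spatial_clampMap, min_eq_right (by exact hy.le)] at h1
    have h2 := Theorems.SwallowTheDatum.KerrShieldedSettles.KerrLeafSojourn.spatialNorm_sub_le_radius a (clampMap θ ρ Gt y)
    change ‖E4.spatial (clampMap θ ρ Gt y)‖ - |a| ≤ _ at h2
    have h3 : (ρ ∘ θ) (y 0) = ρ (θ (y 0)) := rfl
    linarith

end Clamp

/-- Registered one-line form (worker carrier `rechart_clampMap_apply_zero`). [folklore] -/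
theorem rechart_clampMap_apply_zero : open Literature.Geometry.Lorentzian in ∀ (θ ρ Gt : ℝ → ℝ) (y : E4), (E4.ofTimeSpace (θ (y 0)) ((ρ (θ (y 0))) • (WithLp.toLp 2 fun k ↦ Gt ((ρ (θ (y 0)))⁻¹ * E4.spatial y k) : E3))) 0 = θ (y 0) :=
  fun θ ρ Gt y ↦ clampMap_apply_zero θ ρ Gt y

end Summit.FinalStateConjecture.FinalStateConjecture.Theorems.SublinearIsFree.Rechart

end
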